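import Literature.NumberTheory.LFunctions.LogFreeDensityZetaLemmaB
import Literature.NumberTheory.LFunctions.SiegelProductCoefficients
import HarnessLib

/-!
# Bombieri's Lemme B in the Deuring–Heilbronn case (the series side)

Topic `Literature/NumberTheory/LFunctions`, sub-namespace `LogFreeDensity`. Everything here is
PROVED. Bombieri, *Le grand crible* (Astérisque 18), §6, "deuxième cas": in the presence of an
exceptional zero `β₁ = 1 − δ₁` of `L(s, χ₁)` (`χ₁` real), Lemmes A and B are run with
`F(s, χ) = L'/L(s, χ) + L'/L(s + δ₁, χχ₁)`, whose Dirichlet series is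
`−∑ Λ(n) χ(n) (1 + χ₁(n) n^{-δ₁}) n^{-s}`: the weights `a_n = Λ(n)(1 + χ₁(n) n^{-δ₁})` are small on
average (Lemme C), which produces the factor `δ₁ log T` in Théorème 14.

This file provides the series side for the three configurations used downstream:

* (D1) `χ` mod `q`, `ψ = χχ₁` mod `qr` (`SiegelCoefficients.prodChar`):
  `(L'/L)^{(k)}(s₀, χ) + (L'/L)^{(k)}(s₀ + δ₁, ψ) = (−1)^{k+1} k! r^{-k} · 2 ∑_n g_n`
  with `g_n = w(n) χ(n) n^{-1-iv} p_k(r log n)`, `w = Λ(1 + χ₁ n^{-δ₁})/2` (`dhW`;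
  `iteratedDeriv_add_D1`);
* (D2) `χ = χ₁`, `ζ` in place of `L(s, χ₁²)`:
  `(L'/L)^{(k)}(s₀, χ₁) + (ζ₁'/ζ₁)^{(k)}(s₀ + δ₁) − (−1)^k k!/(s₀ − β₁)^{k+1} = (−1)^{k+1} k! r^{-k} 2 ∑ g_n`
  with weights `Λ(χ₁ + n^{-δ₁})/2` (`dhW₀`) and the trivial character mod `1` (`iteratedDeriv_add_D2`);
* (D3) `ζ`: `(ζ₁'/ζ₁)^{(k)}(s₀) + (L'/L)^{(k)}(s₀ + δ₁, χ₁)` equals the `dhW`-series for the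
  trivial character plus the pole term `(−1)^k k!/(s₀ − 1)^{k+1}` (`iteratedDeriv_add_D3`);

and the generic form of Lemme B (`lemmeB_generic`): the output of Lemme A on the series side (as a
hypothesis, slack `η ≤ 4`) implies `(e^{-10}/η²) x^{-r/10}/r³ ≤ ∫ ‖S(t)‖² dt/t` via
`LogFreeDensity.lemmeB_core`; `absorb_pole` is the inequality absorbing the pole of `ζ`.

## References
* [Bombieri1987GrandCrible] §6, pp. 43–48 (Lemmes A, B, "deuxième cas").
-/

noncomputable section

open Complex Finset Filter Real MeasureTheory
open scoped LSeries.notation ArithmeticFunction.vonMangoldt Topology Nat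

namespace Literature.NumberTheory.LFunctions.LogFreeDensity

open Literature.NumberTheory.LFunctions Literature.NumberTheory.LFunctions.SiegelCoefficients

/-! ### Real characters and the Deuring–Heilbronn weights -/

/-- A character with `χ² = χ₀` takes real values. [folklore] -/
theorem apply_eq_re_of_sq_eq_one {r : ℕ} (χ₁ : DirichletCharacter ℂ r) (h : χ₁ ^ 2 = 1)
    (a : ZMod r) : χ₁ a = (((χ₁ a).re : ℝ) : ℂ) := by
  by_cases ha : IsUnit a
  · have h2 : χ₁ a ^ 2 = 1 := by
      rw [← MulChar.pow_apply' χ₁ two_ne_zero, h, MulChar.one_apply ha]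
    have h3 : (χ₁ a - 1) * (χ₁ a + 1) = 0 := by ring_nf; linear_combination h2
    rcases mul_eq_zero.1 h3 with h4 | h4
    · rw [sub_eq_zero.1 h4]; simp
    · rw [eq_neg_of_add_eq_zero_left h4]; simp
  · rw [MulChar.map_nonunit χ₁ ha]; simp

/-- `|Re χ(a)| ≤ 1`. [folklore] -/
theorem abs_re_apply_le_one {r : ℕ} (χ₁ : DirichletCharacter ℂ r) (a : ZMod r) :
    |(χ₁ a).re| ≤ 1 :=
  (Complex.abs_re_le_norm _).trans (DirichletCharacter.norm_le_one χ₁ a)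

/-- `n^{-δ} ≤ 1` for naturals `n` and `δ ≥ 0` (with `0^{-δ} ∈ {0, 1}`). [folklore] -/
theorem natCast_rpow_neg_le_one (n : ℕ) {d : ℝ} (hd : 0 ≤ d) : (n : ℝ) ^ (-d) ≤ 1 := by
  rcases Nat.eq_zero_or_pos n with rfl | hn
  · simp only [Nat.cast_zero]; exact Real.zero_rpow_le_one _
  · exact Real.rpow_le_one_of_one_le_of_nonpos (by exact_mod_cast hn) (by linarith)

/-- The Deuring–Heilbronn weights `w(n) = Λ(n)(1 + χ₁(n) n^{-δ₁})/2`. [cite: Bombieri1987GrandCrible, §6 Lemme C] -/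
def dhW {r : ℕ} (χ₁ : DirichletCharacter ℂ r) (δ₁ : ℝ) (n : ℕ) : ℝ :=
  Λ n * (1 + (χ₁ n).re * (n : ℝ) ^ (-δ₁)) / 2

/-- The weights for `χ = χ₁`: `w₀(n) = Λ(n)(χ₁(n) + n^{-δ₁})/2`. [cite: Bombieri1987GrandCrible, §6 Lemme C] -/
def dhW₀ {r : ℕ} (χ₁ : DirichletCharacter ℂ r) (δ₁ : ℝ) (n : ℕ) : ℝ :=
  Λ n * ((χ₁ n).re + (n : ℝ) ^ (-δ₁)) / 2

/-- `0 ≤ w(n) ≤ Λ(n)`, hence `|w| ≤ Λ`. [folklore] -/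
theorem abs_dhW_le {r : ℕ} (χ₁ : DirichletCharacter ℂ r) {δ₁ : ℝ} (hδ : 0 ≤ δ₁) (n : ℕ) :
    |dhW χ₁ δ₁ n| ≤ Λ n := by
  unfold dhW
  have h1 := abs_re_apply_le_one χ₁ n
  have h2 := natCast_rpow_neg_le_one n hδ
  have h3 : 0 ≤ (n : ℝ) ^ (-δ₁) := Real.rpow_nonneg (Nat.cast_nonneg n) _
  have h4 : |(χ₁ n).re * (n : ℝ) ^ (-δ₁)| ≤ 1 := by
    rw [abs_mul, abs_of_nonneg h3]; nlinarith [abs_nonneg (χ₁ n).re]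
  have h5 : |1 + (χ₁ n).re * (n : ℝ) ^ (-δ₁)| ≤ 2 := by
    have := abs_add_le (1 : ℝ) ((χ₁ n).re * (n : ℝ) ^ (-δ₁)); rw [abs_one] at this; linarith
  rw [abs_div, abs_mul, abs_of_nonneg ArithmeticFunction.vonMangoldt_nonneg, abs_two]
  have h0 : 0 ≤ Λ n := ArithmeticFunction.vonMangoldt_nonneg
  calc Λ n * |1 + (χ₁ n).re * (n : ℝ) ^ (-δ₁)| / 2 ≤ Λ n * 2 / 2 := by gcongr
    _ = Λ n := by ring

/-- `|w₀| ≤ Λ`. [folklore] -/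
theorem abs_dhW₀_le {r : ℕ} (χ₁ : DirichletCharacter ℂ r) {δ₁ : ℝ} (hδ : 0 ≤ δ₁) (n : ℕ) :
    |dhW₀ χ₁ δ₁ n| ≤ Λ n := by
  unfold dhW₀
  have h1 := abs_re_apply_le_one χ₁ n
  have h2 := natCast_rpow_neg_le_one n hδ
  have h3 : 0 ≤ (n : ℝ) ^ (-δ₁) := Real.rpow_nonneg (Nat.cast_nonneg n) _
  have h5 : |(χ₁ n).re + (n : ℝ) ^ (-δ₁)| ≤ 2 := by
    have := abs_add_le (χ₁ n).re ((n : ℝ) ^ (-δ₁)); rw [abs_of_nonneg h3] at this; linarith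
  rw [abs_div, abs_mul, abs_of_nonneg ArithmeticFunction.vonMangoldt_nonneg, abs_two]
  have h0 : 0 ≤ Λ n := ArithmeticFunction.vonMangoldt_nonneg
  calc Λ n * |(χ₁ n).re + (n : ℝ) ^ (-δ₁)| / 2 ≤ Λ n * 2 / 2 := by gcongr
    _ = Λ n := by ring

/-! ### Term identities -/

/-- General-weight version of `term_eq_coef_mul_pk`: for real `u` and `s₀ = 1 + r + iv`,
`(log n)^k χ(n) u(n) n^{-s₀} = k! r^{-k} · (u(n) χ(n) n^{-1-iv}) · p_k(r log n)`. [cite: Bombieri1987GrandCrible, §6 Lemme B (proof)] -/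
theorem term_eq_coefW_mul_pk (u : ℕ → ℝ) {q : ℕ} (χ : DirichletCharacter ℂ q) (v : ℝ) {r : ℝ}
    (hr : 0 < r) (k : ℕ) {n : ℕ} (hn : n ≠ 0) :
    LSeries.term (fun n => (Real.log n : ℂ) ^ k * (χ n * (u n : ℂ))) (((1 + r : ℝ) : ℂ) + (v : ℂ) * I) n =
      (k.factorial : ℂ) * (r⁻¹ : ℂ) ^ k * coefW u χ v n * (pk k (r * Real.log n) : ℂ) := by
  have hn0 : (0 : ℝ) < n := by exact_mod_cast Nat.pos_of_ne_zero hn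
  have hnC : (n : ℂ) ≠ 0 := by exact_mod_cast hn
  rw [LSeries.term_of_ne_zero hn, coefW]
  have hsplit : (n : ℂ) ^ (((1 + r : ℝ) : ℂ) + (v : ℂ) * I) =
      (n : ℂ) ^ ((1 : ℂ) + (v : ℂ) * I) * (((n : ℝ) ^ r : ℝ) : ℂ) := by
    rw [show (((1 + r : ℝ) : ℂ) + (v : ℂ) * I) = ((1 : ℂ) + (v : ℂ) * I) + (r : ℂ) by push_cast; ring,
      Complex.cpow_add _ _ hnC, Complex.ofReal_cpow hn0.le]
    norm_cast
  have hreal := pow_log_mul_rpow_neg_eq hr k hn0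
  have hfac : (k.factorial : ℝ) ≠ 0 := by positivity
  have hreal' : Real.log n ^ k * (n : ℝ) ^ (-r) = (k.factorial : ℝ) * (r⁻¹ ^ k * pk k (r * Real.log n)) := by
    rw [← hreal]; field_simp
  have hrpow : ((n : ℝ) ^ r : ℝ) ≠ 0 := (Real.rpow_pos_of_pos hn0 r).ne'
  have hneg : (((n : ℝ) ^ (-r) : ℝ) : ℂ) = ((((n : ℝ) ^ r : ℝ) : ℂ))⁻¹ := by
    rw [Real.rpow_neg hn0.le]; push_cast; rfl
  have hcpow1 : (n : ℂ) ^ ((1 : ℂ) + (v : ℂ) * I) ≠ 0 := by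
    rw [Ne, Complex.cpow_eq_zero_iff]; exact fun h => hnC h.1
  rw [hsplit, show (-(1 + (v : ℂ) * I)) = -((1 : ℂ) + (v : ℂ) * I) by ring, Complex.cpow_neg]
  have hcast := congr_arg (fun x : ℝ => (x : ℂ)) hreal'
  simp only [Complex.ofReal_mul, Complex.ofReal_pow, Complex.ofReal_natCast, Complex.ofReal_inv] at hcast
  rw [hneg] at hcast
  field_simp
  linear_combination (χ n * (u n : ℂ)) * hcast

/-- Shifting the argument by a real `δ ≥ 0` multiplies the coefficients by `n^{-δ}`. [folklore] -/
theorem term_add_real_eq (f : ℕ → ℂ) (s : ℂ) (d : ℝ) (n : ℕ) :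
    LSeries.term f (s + d) n = LSeries.term (fun n => f n * (((n : ℝ) ^ (-d) : ℝ) : ℂ)) s n := by
  rcases Nat.eq_zero_or_pos n with rfl | hn
  · simp [LSeries.term_zero]
  have hn0 : (0 : ℝ) < n := by exact_mod_cast hn
  have hnC : (n : ℂ) ≠ 0 := by exact_mod_cast hn.ne'
  rw [LSeries.term_of_ne_zero hn.ne', LSeries.term_of_ne_zero hn.ne', Complex.cpow_add _ _ hnC,
    Real.rpow_neg hn0.le]
  push_cast
  rw [Complex.ofReal_cpow hn0.le]
  push_cast
  have h1 : (n : ℂ) ^ (d : ℂ) ≠ 0 := by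
    rw [Ne, Complex.cpow_eq_zero_iff]; exact fun h => hnC h.1
  field_simp

/-- Summability of the `L`-series of `log^k · χΛ` for `Re s > 1`. [folklore] -/
theorem lseriesSummable_logMul_twist {q : ℕ} (χ : DirichletCharacter ℂ q) {s : ℂ} (hs : 1 < s.re)
    (k : ℕ) : LSeriesSummable (LSeries.logMul^[k] (↗χ * ↗Λ)) s := by
  have habs : LSeries.abscissaOfAbsConv (LSeries.logMul^[k] (↗χ * ↗Λ)) ≤ 1 := by
    induction k with
    | zero => exact abscissaOfAbsConv_twist_vonMangoldt_le χ
    | succ k ih => rw [Function.iterate_succ', Function.comp, LSeries.abscissaOfAbsConv_logMul]; exact ih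
  exact LSeriesSummable_of_abscissaOfAbsConv_lt_re (lt_of_le_of_lt habs (by exact_mod_cast hs))

/-- `coefW` is additive in the weight. [folklore] -/
theorem coefW_add (u₁ u₂ : ℕ → ℝ) {q : ℕ} (χ : DirichletCharacter ℂ q) (v : ℝ) (n : ℕ) :
    coefW (fun n => u₁ n + u₂ n) χ v n = coefW u₁ χ v n + coefW u₂ χ v n := by
  unfold coefW; push_cast; ring

/-- `coefW` is homogeneous in the weight. [folklore] -/
theorem coefW_const_mul (c : ℝ) (u : ℕ → ℝ) {q : ℕ} (χ : DirichletCharacter ℂ q) (v : ℝ) (n : ℕ) :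
    coefW (fun n => c * u n) χ v n = (c : ℂ) * coefW u χ v n := by
  unfold coefW; push_cast; ring

/-! ### (D1) `F = L'/L(s, χ) + L'/L(s + δ₁, χχ₁)` -/

/-- **(D1)** For `χ` mod `q`, `χ₁` real mod `r`, `ψ = χχ₁` mod `qr`, `δ₁ ≥ 0`, `s₀ = 1 + r' + iv`:
`(L'/L)^{(k)}(s₀, χ) + (L'/L)^{(k)}(s₀ + δ₁, ψ) = (−1)^{k+1} k! r'^{-k} · 2 ∑_n w(n)χ(n)n^{-1-iv}p_k(r' log n)`,
`w = Λ(1 + χ₁ n^{-δ₁})/2`. [cite: Bombieri1987GrandCrible, §6, p. 43 and Lemme B (proof)] -/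
theorem iteratedDeriv_add_D1 {q r : ℕ} [NeZero q] [NeZero r] (χ : DirichletCharacter ℂ q)
    (χ₁ : DirichletCharacter ℂ r) (hχ₁ : χ₁ ^ 2 = 1) {δ₁ : ℝ} (hδ : 0 ≤ δ₁) (v : ℝ) {r' : ℝ}
    (hr : 0 < r') (k : ℕ) :
    iteratedDeriv k (logDeriv χ.LFunction) (((1 + r' : ℝ) : ℂ) + (v : ℂ) * I) +
        iteratedDeriv k (logDeriv (prodChar χ χ₁).LFunction) (((1 + r' : ℝ) : ℂ) + (v : ℂ) * I + δ₁) =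
      (-1) ^ (k + 1) * ((k.factorial : ℂ) * (r'⁻¹ : ℂ) ^ k *
        (2 * ∑' n, gTermW (dhW χ₁ δ₁) χ v r' k n)) := by
  haveI : NeZero (q * r) := ⟨Nat.mul_ne_zero (NeZero.ne q) (NeZero.ne r)⟩
  set s₀ : ℂ := ((1 + r' : ℝ) : ℂ) + (v : ℂ) * I with hs₀
  set ψ := prodChar χ χ₁ with hψ
  have hs₀re : 1 < s₀.re := by simp [hs₀]; linarith
  have hs₁re : 1 < (s₀ + δ₁).re := by simp [hs₀]; linarith
  set u : ℕ → ℝ := fun n => (χ₁ n).re * Λ n * (n : ℝ) ^ (-δ₁) with hu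
  have hw : (fun n => Λ n + u n) = fun n => (2 : ℝ) * dhW χ₁ δ₁ n := by
    funext m; rw [hu, dhW]; ring
  have hterm : ∀ n : ℕ, LSeries.term (LSeries.logMul^[k] (↗χ * ↗Λ)) s₀ n +
      LSeries.term (LSeries.logMul^[k] (↗ψ * ↗Λ)) (s₀ + δ₁) n =
      (k.factorial : ℂ) * (r'⁻¹ : ℂ) ^ k * (2 * gTermW (dhW χ₁ δ₁) χ v r' k n) := by
    intro n
    rcases Nat.eq_zero_or_pos n with rfl | hn
    · simp [LSeries.term_zero, gTermW_zero (fun n => abs_dhW_le χ₁ hδ n)]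
    have h1 : LSeries.term (LSeries.logMul^[k] (↗χ * ↗Λ)) s₀ n =
        (k.factorial : ℂ) * (r'⁻¹ : ℂ) ^ k * coefW (fun n => Λ n) χ v n * (pk k (r' * Real.log n) : ℂ) := by
      rw [← term_eq_coefW_mul_pk (fun n => Λ n) χ v hr k hn.ne']
      refine LSeries.term_congr (fun {m} _ => ?_) _ _
      rw [logMul_iterate_apply]; rfl
    have h2 : LSeries.term (LSeries.logMul^[k] (↗ψ * ↗Λ)) (s₀ + δ₁) n =
        (k.factorial : ℂ) * (r'⁻¹ : ℂ) ^ k * coefW u χ v n * (pk k (r' * Real.log n) : ℂ) := by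
      rw [term_add_real_eq, ← term_eq_coefW_mul_pk u χ v hr k hn.ne']
      refine LSeries.term_congr (fun {m} _ => ?_) _ _
      rw [logMul_iterate_apply, Pi.mul_apply, hψ, prodChar_apply_natCast, apply_eq_re_of_sq_eq_one χ₁ hχ₁,
        hu]
      push_cast
      ring
    have hadd : coefW (fun n => Λ n) χ v n + coefW u χ v n = (2 : ℂ) * coefW (dhW χ₁ δ₁) χ v n := by
      rw [← coefW_add, hw, coefW_const_mul]; push_cast; rfl
    rw [h1, h2, gTermW]
    linear_combination ((k.factorial : ℂ) * (r'⁻¹ : ℂ) ^ k * (pk k (r' * Real.log n) : ℂ)) * hadd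
  rw [iteratedDeriv_logDeriv_LFunction_eq χ hs₀re k, iteratedDeriv_logDeriv_LFunction_eq ψ hs₁re k,
    ← mul_add, LSeries, LSeries,
    ← (lseriesSummable_logMul_twist χ hs₀re k).tsum_add (lseriesSummable_logMul_twist ψ hs₁re k),
    tsum_congr hterm, tsum_mul_left, tsum_mul_left]

/-! ### (D2) `χ = χ₁`: `F = L'/L(s, χ₁) + ζ'/ζ(s + δ₁)` -/

/-- **(D2)** For real `χ₁` mod `r`, `δ₁ ≥ 0`, `s₀ = 1 + r' + iv`:
`(L'/L)^{(k)}(s₀, χ₁) + (ζ₁'/ζ₁)^{(k)}(s₀ + δ₁) − (−1)^k k!/(s₀ + δ₁ − 1)^{k+1}`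
`= (−1)^{k+1} k! r'^{-k} · 2 ∑_n w₀(n) n^{-1-iv} p_k(r' log n)`, `w₀ = Λ(χ₁ + n^{-δ₁})/2`, the series
taken with the trivial character mod `1` (`ζ₁ = (s−1)ζ`; the subtracted pole term is the one that
compensates the exceptional zero `β₁ = 1 − δ₁` of `L(s, χ₁)`). [cite: Bombieri1987GrandCrible, §6, p. 43] -/
theorem iteratedDeriv_add_D2 {r : ℕ} [NeZero r] (χ₁ : DirichletCharacter ℂ r) (hχ₁ : χ₁ ^ 2 = 1)
    {δ₁ : ℝ} (hδ : 0 ≤ δ₁) (v : ℝ) {r' : ℝ} (hr : 0 < r') (k : ℕ) :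
    iteratedDeriv k (logDeriv χ₁.LFunction) (((1 + r' : ℝ) : ℂ) + (v : ℂ) * I) +
        iteratedDeriv k (logDeriv riemannZeta₁) (((1 + r' : ℝ) : ℂ) + (v : ℂ) * I + δ₁) -
        (-1) ^ k * k.factorial * (1 / (((1 + r' : ℝ) : ℂ) + (v : ℂ) * I + δ₁ - 1) ^ (k + 1)) =
      (-1) ^ (k + 1) * ((k.factorial : ℂ) * (r'⁻¹ : ℂ) ^ k *
        (2 * ∑' n, gTermW (dhW₀ χ₁ δ₁) (1 : DirichletCharacter ℂ 1) v r' k n)) := by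
  set s₀ : ℂ := ((1 + r' : ℝ) : ℂ) + (v : ℂ) * I with hs₀
  have hs₀re : 1 < s₀.re := by simp [hs₀]; linarith
  have hs₁re : 1 < (s₀ + δ₁).re := by simp [hs₀]; linarith
  have hsumζ : Summable fun n => LSeries.term (LSeries.logMul^[k] ↗Λ) (s₀ + δ₁) n := by
    have := lseriesSummable_logMul_twist (1 : DirichletCharacter ℂ 1) hs₁re k
    rwa [one_mul_vonMangoldt_eq] at this
  set u₁ : ℕ → ℝ := fun n => (χ₁ n).re * Λ n with hu₁
  set u₂ : ℕ → ℝ := fun n => Λ n * (n : ℝ) ^ (-δ₁) with hu₂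
  have hw : (fun n => u₁ n + u₂ n) = fun n => (2 : ℝ) * dhW₀ χ₁ δ₁ n := by
    funext m; rw [hu₁, hu₂, dhW₀]; ring
  have hterm : ∀ n : ℕ, LSeries.term (LSeries.logMul^[k] (↗χ₁ * ↗Λ)) s₀ n +
      LSeries.term (LSeries.logMul^[k] ↗Λ) (s₀ + δ₁) n =
      (k.factorial : ℂ) * (r'⁻¹ : ℂ) ^ k * (2 * gTermW (dhW₀ χ₁ δ₁) (1 : DirichletCharacter ℂ 1) v r' k n) := by
    intro n
    rcases Nat.eq_zero_or_pos n with rfl | hn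
    · simp [LSeries.term_zero, gTermW_zero (fun n => abs_dhW₀_le χ₁ hδ n)]
    have h1 : LSeries.term (LSeries.logMul^[k] (↗χ₁ * ↗Λ)) s₀ n =
        (k.factorial : ℂ) * (r'⁻¹ : ℂ) ^ k * coefW u₁ (1 : DirichletCharacter ℂ 1) v n *
          (pk k (r' * Real.log n) : ℂ) := by
      rw [← term_eq_coefW_mul_pk u₁ (1 : DirichletCharacter ℂ 1) v hr k hn.ne']
      refine LSeries.term_congr (fun {m} _ => ?_) _ _
      rw [logMul_iterate_apply, Pi.mul_apply, apply_eq_re_of_sq_eq_one χ₁ hχ₁, hu₁,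
        MulChar.one_apply (isUnit_of_subsingleton _)]
      push_cast; ring
    have h2 : LSeries.term (LSeries.logMul^[k] ↗Λ) (s₀ + δ₁) n =
        (k.factorial : ℂ) * (r'⁻¹ : ℂ) ^ k * coefW u₂ (1 : DirichletCharacter ℂ 1) v n *
          (pk k (r' * Real.log n) : ℂ) := by
      rw [term_add_real_eq, ← term_eq_coefW_mul_pk u₂ (1 : DirichletCharacter ℂ 1) v hr k hn.ne']
      refine LSeries.term_congr (fun {m} _ => ?_) _ _
      rw [logMul_iterate_apply, hu₂, MulChar.one_apply (isUnit_of_subsingleton _)]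
      push_cast; ring
    have hadd : coefW u₁ (1 : DirichletCharacter ℂ 1) v n + coefW u₂ (1 : DirichletCharacter ℂ 1) v n =
        (2 : ℂ) * coefW (dhW₀ χ₁ δ₁) (1 : DirichletCharacter ℂ 1) v n := by
      rw [← coefW_add, hw, coefW_const_mul]; push_cast; rfl
    rw [h1, h2, gTermW]
    linear_combination ((k.factorial : ℂ) * (r'⁻¹ : ℂ) ^ k * (pk k (r' * Real.log n) : ℂ)) * hadd
  rw [iteratedDeriv_logDeriv_LFunction_eq χ₁ hs₀re k, iteratedDeriv_logDeriv_riemannZeta₁_eq hs₁re k,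
    show ∀ A B C : ℂ, A + (B + C) - C = A + B from fun A B C => by ring, ← mul_add, LSeries, LSeries,
    ← (lseriesSummable_logMul_twist χ₁ hs₀re k).tsum_add hsumζ, tsum_congr hterm, tsum_mul_left,
    tsum_mul_left]

/-! ### (D3) `ζ`: `F = ζ'/ζ(s) + L'/L(s + δ₁, χ₁)` -/

/-- **(D3)** For real `χ₁` mod `r`, `δ₁ ≥ 0`, `s₀ = 1 + r' + iv`:
`(ζ₁'/ζ₁)^{(k)}(s₀) + (L'/L)^{(k)}(s₀ + δ₁, χ₁) = (−1)^{k+1} k! r'^{-k} 2 ∑_n w(n) n^{-1-iv}p_k(r' log n) + (−1)^k k!/(s₀−1)^{k+1}`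
with `w = Λ(1 + χ₁ n^{-δ₁})/2` and the trivial character mod `1`. [cite: Bombieri1987GrandCrible, §6, p. 43] -/
theorem iteratedDeriv_add_D3 {r : ℕ} [NeZero r] (χ₁ : DirichletCharacter ℂ r) (hχ₁ : χ₁ ^ 2 = 1)
    {δ₁ : ℝ} (hδ : 0 ≤ δ₁) (v : ℝ) {r' : ℝ} (hr : 0 < r') (k : ℕ) :
    iteratedDeriv k (logDeriv riemannZeta₁) (((1 + r' : ℝ) : ℂ) + (v : ℂ) * I) +
        iteratedDeriv k (logDeriv χ₁.LFunction) (((1 + r' : ℝ) : ℂ) + (v : ℂ) * I + δ₁) =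
      (-1) ^ (k + 1) * ((k.factorial : ℂ) * (r'⁻¹ : ℂ) ^ k *
        (2 * ∑' n, gTermW (dhW χ₁ δ₁) (1 : DirichletCharacter ℂ 1) v r' k n)) +
        (-1) ^ k * k.factorial * (1 / (((1 + r' : ℝ) : ℂ) + (v : ℂ) * I - 1) ^ (k + 1)) := by
  set s₀ : ℂ := ((1 + r' : ℝ) : ℂ) + (v : ℂ) * I with hs₀
  have hs₀re : 1 < s₀.re := by simp [hs₀]; linarith
  have hs₁re : 1 < (s₀ + δ₁).re := by simp [hs₀]; linarith
  have hsumζ : Summable fun n => LSeries.term (LSeries.logMul^[k] ↗Λ) s₀ n := by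
    have := lseriesSummable_logMul_twist (1 : DirichletCharacter ℂ 1) hs₀re k
    rwa [one_mul_vonMangoldt_eq] at this
  set u₂ : ℕ → ℝ := fun n => (χ₁ n).re * Λ n * (n : ℝ) ^ (-δ₁) with hu₂
  have hw : (fun n => Λ n + u₂ n) = fun n => (2 : ℝ) * dhW χ₁ δ₁ n := by
    funext m; rw [hu₂, dhW]; ring
  have hterm : ∀ n : ℕ, LSeries.term (LSeries.logMul^[k] ↗Λ) s₀ n +
      LSeries.term (LSeries.logMul^[k] (↗χ₁ * ↗Λ)) (s₀ + δ₁) n =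
      (k.factorial : ℂ) * (r'⁻¹ : ℂ) ^ k * (2 * gTermW (dhW χ₁ δ₁) (1 : DirichletCharacter ℂ 1) v r' k n) := by
    intro n
    rcases Nat.eq_zero_or_pos n with rfl | hn
    · simp [LSeries.term_zero, gTermW_zero (fun n => abs_dhW_le χ₁ hδ n)]
    have h1 : LSeries.term (LSeries.logMul^[k] ↗Λ) s₀ n =
        (k.factorial : ℂ) * (r'⁻¹ : ℂ) ^ k * coefW (fun n => Λ n) (1 : DirichletCharacter ℂ 1) v n *
          (pk k (r' * Real.log n) : ℂ) := by
      rw [← term_eq_coefW_mul_pk (fun n => Λ n) (1 : DirichletCharacter ℂ 1) v hr k hn.ne']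
      refine LSeries.term_congr (fun {m} _ => ?_) _ _
      rw [logMul_iterate_apply, MulChar.one_apply (isUnit_of_subsingleton _)]
      push_cast; ring
    have h2 : LSeries.term (LSeries.logMul^[k] (↗χ₁ * ↗Λ)) (s₀ + δ₁) n =
        (k.factorial : ℂ) * (r'⁻¹ : ℂ) ^ k * coefW u₂ (1 : DirichletCharacter ℂ 1) v n *
          (pk k (r' * Real.log n) : ℂ) := by
      rw [term_add_real_eq, ← term_eq_coefW_mul_pk u₂ (1 : DirichletCharacter ℂ 1) v hr k hn.ne']
      refine LSeries.term_congr (fun {m} _ => ?_) _ _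
      rw [logMul_iterate_apply, Pi.mul_apply, apply_eq_re_of_sq_eq_one χ₁ hχ₁, hu₂,
        MulChar.one_apply (isUnit_of_subsingleton _)]
      push_cast; ring
    have hadd : coefW (fun n => Λ n) (1 : DirichletCharacter ℂ 1) v n + coefW u₂ (1 : DirichletCharacter ℂ 1) v n =
        (2 : ℂ) * coefW (dhW χ₁ δ₁) (1 : DirichletCharacter ℂ 1) v n := by
      rw [← coefW_add, hw, coefW_const_mul]; push_cast; rfl
    rw [h1, h2, gTermW]
    linear_combination ((k.factorial : ℂ) * (r'⁻¹ : ℂ) ^ k * (pk k (r' * Real.log n) : ℂ)) * hadd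
  rw [iteratedDeriv_logDeriv_LFunction_eq χ₁ hs₁re k, iteratedDeriv_logDeriv_riemannZeta₁_eq hs₀re k,
    show ∀ A B C : ℂ, A + C + B = (A + B) + C from fun A B C => by ring, ← mul_add, LSeries, LSeries,
    ← hsumζ.tsum_add (lseriesSummable_logMul_twist χ₁ hs₁re k), tsum_congr hterm, tsum_mul_left,
    tsum_mul_left]

/-! ### Absorbing the pole of `ζ`, and the generic Lemme B -/

/-- If `e^{-10K}(2r)^{-(k+1)} ≤ X + 3^{-(k+1)}` with `K ≤ k` and `r ≤ e^{-11}`, then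
`e^{-10K}(2r)^{-(k+1)}/2 ≤ X` (the pole term `k!/|s₀ − 1|^{k+1} ≤ k! 3^{-(k+1)}`, `|v| ≥ 3`, is at most
half the main term). [cite: Bombieri1987GrandCrible, §6, p. 43] -/
theorem absorb_pole {K k : ℕ} {r X : ℝ} (hr : 0 < r) (hr11 : r ≤ Real.exp (-11)) (hk : K ≤ k)
    (h : Real.exp (-(10 * K)) * (2 * r)⁻¹ ^ (k + 1) ≤ X + 3⁻¹ ^ (k + 1)) :
    Real.exp (-(10 * K)) * (2 * r)⁻¹ ^ (k + 1) / 2 ≤ X := by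
  have hsmall : (3 : ℝ)⁻¹ ^ (k + 1) ≤ Real.exp (-(10 * K)) * (2 * r)⁻¹ ^ (k + 1) / 2 := by
    rw [le_div_iff₀ (by norm_num)]
    have h2r : 0 < 2 * r := by positivity
    have hq : (3 : ℝ)⁻¹ ^ (k + 1) = (2 * r / 3) ^ (k + 1) * (2 * r)⁻¹ ^ (k + 1) := by
      rw [← mul_pow]; congr 1; field_simp
    rw [hq]
    have he1 : Real.exp (-11) ≤ 1 := Real.exp_le_one_iff.2 (by norm_num)
    have hbase : 2 * r / 3 ≤ 1 := by linarith
    have hbase0 : 0 ≤ 2 * r / 3 := by positivity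
    have hp1 : (2 * r / 3) ^ (k + 1) ≤ (2 * r / 3) ^ (K + 1) :=
      pow_le_pow_of_le_one hbase0 hbase (by omega)
    have hp2 : (2 * r / 3) ^ K * Real.exp (10 * K) ≤ 1 := by
      rw [show Real.exp (10 * K) = (Real.exp 10) ^ K by rw [← Real.exp_nat_mul]; ring_nf, ← mul_pow]
      refine pow_le_one₀ (by positivity) ?_
      have h1 : r * Real.exp 10 ≤ Real.exp (-11) * Real.exp 10 :=
        mul_le_mul_of_nonneg_right hr11 (Real.exp_pos 10).le
      rw [← Real.exp_add] at h1
      have he : Real.exp (-11 + 10) ≤ 1 := Real.exp_le_one_iff.2 (by norm_num)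
      have : 2 * r / 3 * Real.exp 10 = 2 / 3 * (r * Real.exp 10) := by ring
      rw [this]; linarith
    have hexpK : Real.exp (-(10 * K)) * Real.exp (10 * K) = 1 := by rw [← Real.exp_add]; simp
    have hpos : 0 < (2 * r)⁻¹ ^ (k + 1) := by positivity
    have key : (2 * r / 3) ^ (k + 1) * 2 ≤ Real.exp (-(10 * K)) := by
      have h3 : (2 * r / 3) ^ (K + 1) * 2 ≤ Real.exp (-(10 * K)) := by
        rw [pow_succ]
        have h4 : (2 * r / 3) ^ K ≤ Real.exp (-(10 * K)) := by
          have := mul_le_mul_of_nonneg_right hp2 (Real.exp_pos (-(10 * K))).le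
          rwa [mul_assoc, mul_comm (Real.exp (10 * K)), hexpK, mul_one, one_mul] at this
        have h5 : 2 * r / 3 * 2 ≤ 1 := by
          have he2 : Real.exp (-11) ≤ 1 / 2 := by
            have h6 := Real.exp_le_exp.2 (show (-11:ℝ) ≤ -1 by norm_num)
            have h7 : Real.exp (-1) ≤ 1 / 2 := by
              rw [Real.exp_neg, inv_le_comm₀ (Real.exp_pos 1) (by norm_num)]
              linarith [Real.exp_one_gt_d9]
            linarith
          linarith
        calc (2 * r / 3) ^ K * (2 * r / 3) * 2 = (2 * r / 3) ^ K * (2 * r / 3 * 2) := by ring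
          _ ≤ Real.exp (-(10 * K)) * 1 := mul_le_mul h4 h5 (by positivity) (Real.exp_pos _).le
          _ = _ := mul_one _
      exact le_trans (mul_le_mul_of_nonneg_right hp1 (by norm_num)) h3
    calc (2 * r / 3) ^ (k + 1) * (2 * r)⁻¹ ^ (k + 1) * 2
        = ((2 * r / 3) ^ (k + 1) * 2) * (2 * r)⁻¹ ^ (k + 1) := by ring
      _ ≤ Real.exp (-(10 * K)) * (2 * r)⁻¹ ^ (k + 1) := mul_le_mul_of_nonneg_right key hpos.le
  linarith

/-- From `e^{-10K}(2r)^{-(k+1)} / c ≤ 2 r^{-k} ‖∑ g‖` (`c = 1` or `2`) to the hypothesis of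
`lemmeB_core` with `η = 2c`: `e^{-10K} 2^{-(k+1)}/r ≤ 2c ‖∑ g‖`. [folklore] -/
theorem hmain_of_lemmaA {K k : ℕ} {r c S : ℝ} (hr : 0 < r) (hc : 0 < c)
    (h : Real.exp (-(10 * K)) * (2 * r)⁻¹ ^ (k + 1) / c ≤ 2 * (r⁻¹ ^ k * S)) :
    Real.exp (-(10 * K)) * (2⁻¹ ^ (k + 1) / r) ≤ (2 * c) * S := by
  have key : Real.exp (-(10 * K)) * (2⁻¹ ^ (k + 1) / r) =
      r ^ k * (Real.exp (-(10 * K)) * (2 * r)⁻¹ ^ (k + 1)) := by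
    rw [mul_inv, mul_pow, pow_succ r⁻¹ k, inv_pow, inv_pow]
    field_simp
  rw [key]
  rw [div_le_iff₀ hc] at h
  calc r ^ k * (Real.exp (-(10 * K)) * (2 * r)⁻¹ ^ (k + 1))
      ≤ r ^ k * (2 * (r⁻¹ ^ k * S) * c) := mul_le_mul_of_nonneg_left h (by positivity)
    _ = (2 * c) * S * (r ^ k * r⁻¹ ^ k) := by ring
    _ = (2 * c) * S := by rw [← mul_pow, mul_inv_cancel₀ hr.ne', one_pow, mul_one]

/-- `‖Λ(n) χ₀(n) n^{-1-iv} p_k(r log n)‖ = (Λ(n)/n) p_k(r log n)` for the trivial character mod `1`. [folklore] -/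
theorem norm_gTerm_one (v : ℝ) {r : ℝ} (hr : 0 ≤ r) (k n : ℕ) :
    ‖gTerm (1 : DirichletCharacter ℂ 1) v r k n‖ = Λ n / n * pk k (r * Real.log n) := by
  rcases Nat.eq_zero_or_pos n with rfl | hn
  · simp [gTerm_zero]
  unfold gTerm coef
  have hpk : 0 ≤ pk k (r * Real.log n) := pk_nonneg k (mul_nonneg hr (Real.log_natCast_nonneg n))
  rw [norm_mul, Complex.norm_real, Real.norm_eq_abs, abs_of_nonneg hpk, norm_mul, norm_mul,
    Complex.norm_real, Real.norm_eq_abs, abs_of_nonneg ArithmeticFunction.vonMangoldt_nonneg,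
    MulChar.one_apply (isUnit_of_subsingleton _), norm_one, mul_one,
    Complex.norm_natCast_cpow_of_pos hn]
  simp [Real.rpow_neg_one, div_eq_mul_inv]

/-- The weighted series is summable for `|w| ≤ Λ`, `r > 0`. [folklore] -/
theorem summable_gTermW {w : ℕ → ℝ} (hw : ∀ n, |w n| ≤ Λ n) {q : ℕ} (χ : DirichletCharacter ℂ q)
    (v : ℝ) {r : ℝ} (hr : 0 < r) (k : ℕ) : Summable (gTermW w χ v r k) := by
  refine Summable.of_norm_bounded (g := fun n => ‖gTerm (1 : DirichletCharacter ℂ 1) v r k n‖)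
    (summable_gTerm (1 : DirichletCharacter ℂ 1) v hr k).norm fun n => ?_
  rw [norm_gTerm_one v hr.le k n]
  exact norm_gTermW_le hw χ v hr.le k n

/-- **Lemme B, generic form.** For weights `|w| ≤ Λ`, any character `χ`, and the output of Lemme A
on the series side as a hypothesis — for every `K ≥ c₄ rL' + 2` some `k ∈ [K, 2K]` with
`e^{-10K}2^{-(k+1)}/r ≤ η ‖∑_n w(n)χ(n)n^{-1-iv}p_k(r log n)‖`, `1 ≤ η ≤ 4` — one has, for
`0 < r ≤ 1/(112e^{14})`, `rL' ≥ 1`, `log x ≥ 240(c₄ + 8e^{14} + 8) L'`, `z ≤ x^{a₀/2}`: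
`(e^{-10}/η²) x^{-r/10}/r³ ≤ ∫_{⌊x^{a₀}⌋}^{x} ‖S(t)‖² dt/t`. [cite: Bombieri1987GrandCrible, §6 Lemme B] -/
theorem lemmeB_generic {w : ℕ → ℝ} (hw : ∀ n, |w n| ≤ Λ n) {q : ℕ} (χ : DirichletCharacter ℂ q)
    (v : ℝ) {c₄ η r L' x : ℝ} {z : ℕ} (hc₄ : 0 < c₄) (hη1 : 1 ≤ η) (hη4 : η ≤ 4) (hr : 0 < r)
    (hr0 : r ≤ 1 / (112 * Real.exp 14)) (hu : 1 ≤ r * L') (hx : 0 < x)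
    (hlogx : 240 * (c₄ + 8 * Real.exp 14 + 8) * L' ≤ Real.log x) (hz : (z : ℝ) ≤ x ^ (expoB / 2))
    (hAout : ∀ K : ℕ, c₄ * (r * L') + 2 ≤ K → ∃ k ∈ Finset.Icc K (2 * K),
      Real.exp (-(10 * K)) * (2⁻¹ ^ (k + 1) / r) ≤ η * ‖∑' n, gTermW w χ v r k n‖) :
    Real.exp (-10) / η ^ 2 * x ^ (-(r / 10)) / r ^ 3 ≤
      ∫ t in Set.Ioc (⌊x ^ expoB⌋₊ : ℝ) x, ‖summatory (coefSiftedW w χ v x z) t‖ ^ 2 / t := by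
  classical
  set θ : ℝ := Real.exp 14 with hθ
  have hθ1 : 1 ≤ θ := Real.one_le_exp (by norm_num)
  set u : ℝ := r * L' with hudef
  set Lx : ℝ := Real.log x with hLx
  have hrLx : 240 * (c₄ + 8 * θ + 8) * u ≤ r * Lx := by
    rw [hudef]
    have := mul_le_mul_of_nonneg_left hlogx hr.le
    nlinarith [this]
  set K : ℕ := ⌊r * Lx / 240⌋₊ with hKdef
  have hu1 : (1 : ℝ) ≤ u := hu
  have hrLxpos : 0 ≤ r * Lx := by
    have : 0 ≤ 240 * (c₄ + 8 * θ + 8) * u := by positivity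
    linarith
  have hK1 : (K : ℝ) ≤ r * Lx / 240 := Nat.floor_le (by positivity)
  have hKlow : (c₄ + 8 * θ + 8) * u - 1 ≤ K := by
    have hK2 : r * Lx / 240 < K + 1 := Nat.lt_floor_add_one _
    have : (c₄ + 8 * θ + 8) * u ≤ r * Lx / 240 := by
      rw [le_div_iff₀ (by norm_num)]; linarith
    linarith
  have hprod1 : 0 ≤ (8 * θ + 8) * (u - 1) := mul_nonneg (by positivity) (by linarith only [hu1])
  have hprod2 : 0 ≤ c₄ * u := mul_nonneg hc₄.le (by linarith only [hu1])
  have hKc : c₄ * (r * L') + 2 ≤ K := by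
    rw [← hudef]
    nlinarith only [hKlow, hprod1, hθ1, hu1]
  have hK8r : (8 : ℝ) ≤ K := by
    nlinarith only [hKlow, hprod1, hprod2, hθ1, hu1]
  have hK8 : 8 ≤ K := by exact_mod_cast hK8r
  have hKθ : 8 * Real.exp 14 * (r * L') ≤ K := by
    rw [← hθ, ← hudef]; nlinarith only [hKlow, hprod2, hu1]
  obtain ⟨k, hk, hmain⟩ := hAout K hKc
  have hcore := lemmeB_core hw χ v (L' := L') (η := η) hr hr0 hu hx hη1 hη4 hK8 hKθ hk
    (summable_gTermW hw χ v hr k) hmain hz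
  exact hcore

end Literature.NumberTheory.LFunctions.LogFreeDensity
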